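import Summits.AtomisticToContinuum.FouriersLaw.Theorems.OddSectorIrreversibilityCorrectorTheoryTangentBound
import Summits.AtomisticToContinuum.FouriersLaw.Theorems.OddSectorIrreversibilityCorrectorTheorySmooth
import Summits.AtomisticToContinuum.FouriersLaw.Theorems.ClosedConeSensitivity.Negative.TangentReduction
import Summits.AtomisticToContinuum.FouriersLaw.Theorems.OddSectorIrreversibilitySubBallisticWindowStaticCurrentBound
import Summits.AtomisticToContinuum.FouriersLaw.Theorems.JunctionLocalitySuperadditiveResistanceKuboDirichlet
import Summits.AtomisticToContinuum.FouriersLaw.Theorems.BondHeatUncertaintyLightConeBondHeatVirialAlgebra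

/-!
# `CorrectorTheory` (stmt-AtomisticToContinuum-14071), part 7c: the transported bond current and its tangent map

Helper file for support item `stmt-AtomisticToContinuum-14071`
(`OddSectorIrreversibility.CorrectorTheory`, conjunct A (7)).

For the pinned anharmonic chain (`ω₂, lam > 0`, `β ≥ 0`), the closed flow `Φ_s = detFlow` and the
transported current `g_s = j_i ∘ Φ_s` (which is `jt s` of the route decl, the zero-friction kernel
being the Dirac mass at `Φ_s`):

* `norm_fderiv_bondCurrent_le` — `‖Dj_i(z)‖ ≤ (5 + 13β)(1 + H(z))²` (product rule on the closed
  form `j_i = -½(p_i + p_{i+1}) V'(q_{i+1} - q_i)`, energy bounds on `p`, `V'`, `V''`);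
* `contDiff_currentFlow` — `g_s ∈ C^∞`; `abs_partialP_currentFlow_le` —
  **`|∂_{p_b} g_s(x)| ≤ (5 + 13β)(1 + H(x))² e^{K(a_x) s}`** with the tangent rate of part 7b at
  `lam a_x⁴/4 = H(x) + 1` (chain rule + `norm_fderiv_detFlow_le` + energy conservation);
* `integrable_sq_partialP_currentFlow`, `memLp_partialP_currentFlow` — hence
  `∂_{p_b} g_s ∈ L²(μ_T)` for every `s ≥ 0`, `T > 0` (the rate is `O(1 + √H)`:
  `4 s k₁ √((H+1)/lam) ≤ (H+1)/(2T) + 8 T s² k₁²/lam`, and `(1+H)⁴ e^{-H/2T} ∈ L¹`).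

References: folklore (variational equation / Grönwall). Nothing here closes the item.
-/

noncomputable section

open MeasureTheory Filter Topology Set Function Metric
open scoped ContDiff NNReal ENNReal
open Literature.MathematicalPhysics.KineticTheory.HeatConduction
open Literature.MathematicalPhysics.KineticTheory
open Summit.AtomisticToContinuum.FouriersLaw.Theorems.ClosedConeSensitivity.Negative.ZeroFrictionDictionary
open Summit.AtomisticToContinuum.FouriersLaw.Theorems.ClosedConeSensitivity.Negative.TangentReduction
open Summit.AtomisticToContinuum.FouriersLaw.Theorems.SuperadditiveResistance.Kubo
open Summit.AtomisticToContinuum.FouriersLaw.Theorems.SubBallisticWindow.StaticCurrentBound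
open Summit.AtomisticToContinuum.FouriersLaw.Theorems.LightConeBondHeat
open Summit.AtomisticToContinuum.FouriersLaw.Theorems.SuperadditiveResistance.DeviceLiouville

namespace Summit.AtomisticToContinuum.FouriersLaw.Theorems.OddSectorIrreversibility.Corrector

variable {N : ℕ}

/-! ### The derivative of a bond current -/

section Current

variable {ω₂ lam β : ℝ} (hω : 0 ≤ ω₂) (hl : 0 ≤ lam) (hβ : 0 ≤ β) (γ : ℝ)
include hω hl hβ

/-- Energy bounds for the interaction derivatives on a bond `(k, l = k+1)`:
`|V'(r)| ≤ (3 + β)(1 + H)` and `|V''(r)| ≤ (1 + 6β)(1 + H)`, `r = q_l - q_k`. [folklore] -/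
theorem abs_deriv_V_bond_le (x : PhaseSpace N) {k l : Fin N} (hlk : l.val = k.val + 1) :
    |deriv (pinnedChain ω₂ lam β γ).V (x.1 l - x.1 k)| ≤ (3 + β) * (1 + (pinnedChain ω₂ lam β γ).hamiltonian N x) ∧
    |deriv (deriv (pinnedChain ω₂ lam β γ).V) (x.1 l - x.1 k)| ≤ (1 + 6 * β) * (1 + (pinnedChain ω₂ lam β γ).hamiltonian N x) := by
  set P := pinnedChain ω₂ lam β γ with hP
  set H := P.hamiltonian N x with hH
  set r := x.1 l - x.1 k with hr
  have hU0 : ∀ q, 0 ≤ P.U q := fun q => by show 0 ≤ ω₂ * q ^ 2 / 2 + lam * q ^ 4 / 4; positivity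
  have hV0 : ∀ r, 0 ≤ P.V r := fun r => by show 0 ≤ r ^ 2 / 2 + β * r ^ 4 / 4; positivity
  have hH0 : 0 ≤ H := P.hamiltonian_nonneg_of_nonneg hU0 hV0 N x
  have hVle : P.V r ≤ H := P.bond_le_hamiltonian hU0 hV0 N x hlk
  have hVr : P.V r = r ^ 2 / 2 + β * r ^ 4 / 4 := rfl
  have hr2 : r ^ 2 ≤ 2 * H := by nlinarith [sq_nonneg (r ^ 2)]
  have hr4 : β * r ^ 4 ≤ 4 * H := by nlinarith [sq_nonneg r]
  constructor
  · rw [pinnedChain_deriv_V]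
    have h3 : |r| ^ 3 ≤ (r ^ 2 + r ^ 4) / 2 := by
      have := sq_abs r
      nlinarith [sq_nonneg (|r| - 1), abs_nonneg r, sq_nonneg r, pow_abs r 4,
        show |r| ^ 4 = r ^ 4 from by rw [pow_abs, abs_of_nonneg (by positivity)]]
    have hr1 : |r| ≤ 1 + H := by nlinarith [abs_nonneg r, sq_abs r]
    calc |r + β * r ^ 3| ≤ |r| + |β * r ^ 3| := abs_add_le _ _
      _ = |r| + β * |r| ^ 3 := by rw [abs_mul, abs_of_nonneg hβ, abs_pow]
      _ ≤ (1 + H) + β * ((r ^ 2 + r ^ 4) / 2) := add_le_add hr1 (mul_le_mul_of_nonneg_left h3 hβ)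
      _ ≤ (3 + β) * (1 + H) := by nlinarith
  · rw [pinnedChain_deriv_deriv_V]
    rw [abs_of_nonneg (by positivity)]
    nlinarith

/-- **The derivative of a bond current is polynomially bounded**: `‖Dj_i(z)‖ ≤ (5 + 13β)(1 + H(z))²`
(operator norm for the sup norm on phase space). [folklore] -/
theorem norm_fderiv_bondCurrent_le (N : ℕ) (i : Fin N) (z : PhaseSpace N) :
    ‖fderiv ℝ (fun x => (pinnedChain ω₂ lam β γ).bondCurrent N i x) z‖ ≤
      (5 + 13 * β) * (1 + (pinnedChain ω₂ lam β γ).hamiltonian N z) ^ 2 := by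
  set P := pinnedChain ω₂ lam β γ with hP
  set H := P.hamiltonian N z with hH
  have hU0 : ∀ q, 0 ≤ P.U q := fun q => by show 0 ≤ ω₂ * q ^ 2 / 2 + lam * q ^ 4 / 4; positivity
  have hV0 : ∀ r, 0 ≤ P.V r := fun r => by show 0 ≤ r ^ 2 / 2 + β * r ^ 4 / 4; positivity
  have hH0 : 0 ≤ H := P.hamiltonian_nonneg_of_nonneg hU0 hV0 N z
  have hbound0 : 0 ≤ (5 + 13 * β) * (1 + H) ^ 2 := by positivity
  by_cases hi : i.val + 1 < N
  · set l : Fin N := ⟨i.val + 1, hi⟩ with hl'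
    have hfun : (fun x => P.bondCurrent N i x) = fun x : PhaseSpace N =>
        -((x.2 i + x.2 l) / 2 * deriv P.V (x.1 l - x.1 i)) := funext fun x => bondCurrent_eq_of_lt P hi x
    rw [hfun]
    -- the linear pieces
    set A : PhaseSpace N →L[ℝ] ℝ := ((ContinuousLinearMap.proj i).comp (ContinuousLinearMap.snd ℝ (Fin N → ℝ) (Fin N → ℝ))) +
      ((ContinuousLinearMap.proj l).comp (ContinuousLinearMap.snd ℝ (Fin N → ℝ) (Fin N → ℝ))) with hA
    set D : PhaseSpace N →L[ℝ] ℝ := ((ContinuousLinearMap.proj l).comp (ContinuousLinearMap.fst ℝ (Fin N → ℝ) (Fin N → ℝ))) -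
      ((ContinuousLinearMap.proj i).comp (ContinuousLinearMap.fst ℝ (Fin N → ℝ) (Fin N → ℝ))) with hD
    have hAa : ∀ x : PhaseSpace N, A x = x.2 i + x.2 l := fun x => rfl
    have hDa : ∀ x : PhaseSpace N, D x = x.1 l - x.1 i := fun x => rfl
    have hcoord : ∀ (w : PhaseSpace N) (j : Fin N), |w.1 j| ≤ ‖w‖ ∧ |w.2 j| ≤ ‖w‖ := fun w j =>
      ⟨(Real.norm_eq_abs _ ▸ norm_le_pi_norm w.1 j).trans (norm_fst_le w),
       (Real.norm_eq_abs _ ▸ norm_le_pi_norm w.2 j).trans (norm_snd_le w)⟩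
    have hAn : ‖A‖ ≤ 2 := ContinuousLinearMap.opNorm_le_bound _ (by norm_num) fun w => by
      rw [hAa, Real.norm_eq_abs]
      calc |w.2 i + w.2 l| ≤ |w.2 i| + |w.2 l| := abs_add_le _ _
        _ ≤ ‖w‖ + ‖w‖ := add_le_add (hcoord w i).2 (hcoord w l).2
        _ = 2 * ‖w‖ := by ring
    have hDn : ‖D‖ ≤ 2 := ContinuousLinearMap.opNorm_le_bound _ (by norm_num) fun w => by
      rw [hDa, Real.norm_eq_abs]
      calc |w.1 l - w.1 i| ≤ |w.1 l| + |w.1 i| := abs_sub _ _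
        _ ≤ ‖w‖ + ‖w‖ := add_le_add (hcoord w l).1 (hcoord w i).1
        _ = 2 * ‖w‖ := by ring
    -- `V'` and its derivative
    have hV' : deriv P.V = fun r => r + β * r ^ 3 := funext fun r => pinnedChain_deriv_V ω₂ lam β γ r
    have hV'd : ∀ r, HasDerivAt (deriv P.V) (1 + 3 * β * r ^ 2) r := fun r => by
      rw [hV']
      have h := (hasDerivAt_id r).add ((hasDerivAt_pow 3 r).const_mul β)
      have e : (1 : ℝ) + β * (((3 : ℕ) : ℝ) * r ^ (3 - 1)) = 1 + 3 * β * r ^ 2 := by norm_num; ring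
      rw [e] at h
      exact h
    -- the derivative of the current
    have hcomp : HasFDerivAt (fun x : PhaseSpace N => deriv P.V (D x))
        ((1 + 3 * β * (D z) ^ 2) • D) z := (hV'd (D z)).comp_hasFDerivAt z D.hasFDerivAt
    have hprod : HasFDerivAt (fun x : PhaseSpace N => (-1 / 2 : ℝ) * (A x * deriv P.V (D x)))
        ((-1 / 2 : ℝ) • (A z • ((1 + 3 * β * (D z) ^ 2) • D) + deriv P.V (D z) • A)) z :=
      (A.hasFDerivAt.mul hcomp).const_mul (-1 / 2 : ℝ)
    have hfun2 : (fun x : PhaseSpace N => -((x.2 i + x.2 l) / 2 * deriv P.V (x.1 l - x.1 i))) =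
        fun x => (-1 / 2 : ℝ) * (A x * deriv P.V (D x)) := funext fun x => by rw [hAa, hDa]; ring
    rw [hfun2, hprod.fderiv]
    -- the norm
    obtain ⟨hV1, hV2⟩ := abs_deriv_V_bond_le hω hl hβ γ z (k := i) (l := l) rfl
    rw [← hDa z] at hV1 hV2
    have hp : |A z| ≤ 2 * (1 + H) := by
      rw [hAa]
      calc |z.2 i + z.2 l| ≤ |z.2 i| + |z.2 l| := abs_add_le _ _
        _ ≤ (1 + H) + (1 + H) := add_le_add (abs_momentum_le hω hl hβ γ N z i) (abs_momentum_le hω hl hβ γ N z l)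
        _ = 2 * (1 + H) := by ring
    have e1 : |1 + 3 * β * D z ^ 2| ≤ (1 + 6 * β) * (1 + H) := by
      rw [← pinnedChain_deriv_deriv_V ω₂ lam β γ (D z)]; exact hV2
    have hn1 : ‖A z • ((1 + 3 * β * D z ^ 2) • D)‖ ≤ 2 * (1 + H) * ((1 + 6 * β) * (1 + H)) * 2 := by
      rw [norm_smul, norm_smul, Real.norm_eq_abs, Real.norm_eq_abs]
      calc |A z| * (|1 + 3 * β * D z ^ 2| * ‖D‖) ≤ (2 * (1 + H)) * (((1 + 6 * β) * (1 + H)) * 2) :=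
            mul_le_mul hp (mul_le_mul e1 hDn (norm_nonneg _) (by positivity)) (by positivity) (by positivity)
        _ = _ := by ring
    have hn2 : ‖deriv P.V (D z) • A‖ ≤ (3 + β) * (1 + H) * 2 := by
      rw [norm_smul, Real.norm_eq_abs]
      exact mul_le_mul hV1 hAn (norm_nonneg _) (by positivity)
    calc ‖(-1 / 2 : ℝ) • (A z • ((1 + 3 * β * D z ^ 2) • D) + deriv P.V (D z) • A)‖
        = 1 / 2 * ‖A z • ((1 + 3 * β * D z ^ 2) • D) + deriv P.V (D z) • A‖ := by
          rw [norm_smul, Real.norm_eq_abs]; norm_num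
      _ ≤ 1 / 2 * (2 * (1 + H) * ((1 + 6 * β) * (1 + H)) * 2 + (3 + β) * (1 + H) * 2) := by
          gcongr
          exact (norm_add_le _ _).trans (add_le_add hn1 hn2)
      _ ≤ (5 + 13 * β) * (1 + H) ^ 2 := by nlinarith
  · -- no bond: the current vanishes identically
    have hfun : (fun x => P.bondCurrent N i x) = fun _ : PhaseSpace N => (0 : ℝ) := by
      funext x
      unfold OscillatorChain.bondCurrent
      refine Finset.sum_eq_zero fun j _ => ?_
      rw [if_neg]
      intro hv; exact hi (hv ▸ j.isLt)
    rw [hfun]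
    simp only [fderiv_fun_const, Pi.zero_apply, norm_zero]
    exact hbound0

end Current

/-! ### The transported current `g_s = j_i ∘ Φ_s` and its tangent map -/

/-- The coordinate vector `(0, e_b)` has sup norm at most `1`. [folklore] -/
theorem norm_unitP_le (b : Fin N) : ‖(unitP b : PhaseSpace N)‖ ≤ 1 := by
  rw [unitP_eq, Prod.norm_def, max_le_iff]
  refine ⟨by simp, (pi_norm_le_iff_of_nonneg zero_le_one).2 fun j => ?_⟩
  by_cases hj : j = b
  · subst hj; simp
  · simp [hj]

section Flow

variable {ω₂ lam β : ℝ} (hω : 0 < ω₂) (hl : 0 < lam) (hβ : 0 ≤ β) (γ : ℝ)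
include hω hl hβ

/-- The transported bond current `x ↦ j_i(Φ_s x)` is smooth (`s ≥ 0`). [folklore] -/
theorem contDiff_currentFlow (N : ℕ) (i : Fin N) {s : ℝ} (hs : 0 ≤ s) :
    ContDiff ℝ ∞ fun x : PhaseSpace N => (pinnedChain ω₂ lam β γ).bondCurrent N i (detFlow ω₂ lam β N s x) :=
  (contDiff_bondCurrent _ (pinnedChain_contDiff_V ω₂ lam β γ) N i).comp (contDiff_detFlow hω hl.le hβ N hs)

/-- **The tangent map of the transported current**: for `s ≥ 0`, a bath (or any) coordinate `b`,
and `a, b' ≥ 0` with `H(x) + 1 ≤ lam a⁴/4`, `2(H(x)+1) ≤ b'²`: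
`|∂_{p_b}(j_i ∘ Φ_s)(x)| ≤ (5 + 13β)(1 + H(x))² e^{K(a) s}`, `K(a)` the tangent rate of part 7b
(chain rule, `‖Dj_i‖ ≤ (5+13β)(1+H)²` at `Φ_s x` where `H` is conserved, `‖DΦ_s(x)‖ ≤ e^{K(a)s}`).
[folklore] -/
theorem abs_partialP_currentFlow_le (N : ℕ) (i b : Fin N) {s : ℝ} (hs : 0 ≤ s) {a b' : ℝ} (ha : 0 ≤ a)
    (hb' : 0 ≤ b') (x : PhaseSpace N)
    (haE : (pinnedChain ω₂ lam β 0).hamiltonian N x + 1 ≤ lam * a ^ 4 / 4)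
    (hbE : 2 * ((pinnedChain ω₂ lam β 0).hamiltonian N x + 1) ≤ b' ^ 2) :
    |partialP b (fun y : PhaseSpace N => (pinnedChain ω₂ lam β γ).bondCurrent N i (detFlow ω₂ lam β N s y)) x| ≤
      (5 + 13 * β) * (1 + (pinnedChain ω₂ lam β γ).hamiltonian N x) ^ 2 *
        Real.exp ((1 + N * ((ω₂ + 3 * lam * a ^ 2) + (N : ℝ) ^ 2 * (1 + 12 * β * a ^ 2))) * s) := by
  set P := pinnedChain ω₂ lam β γ with hP
  set K : ℝ := 1 + N * ((ω₂ + 3 * lam * a ^ 2) + (N : ℝ) ^ 2 * (1 + 12 * β * a ^ 2)) with hK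
  set Φ := detFlow ω₂ lam β N s with hΦ
  set j : PhaseSpace N → ℝ := fun y => P.bondCurrent N i y with hj
  have hjd : Differentiable ℝ j := (contDiff_bondCurrent _ (pinnedChain_contDiff_V ω₂ lam β γ) N i).differentiable (by simp)
  have hΦd : Differentiable ℝ Φ := (contDiff_detFlow hω hl.le hβ N hs).differentiable (by simp)
  have hgd : Differentiable ℝ fun y => j (Φ y) := hjd.comp hΦd
  rw [partialP_eq_fderiv hgd]
  change |(fderiv ℝ (j ∘ Φ) x) _| ≤ _
  rw [fderiv_comp x (hjd _) (hΦd x)]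
  simp only [ContinuousLinearMap.coe_comp, Function.comp_apply]
  have hHΦ : P.hamiltonian N (Φ x) = P.hamiltonian N x := by
    rw [show P.hamiltonian N = (pinnedChain ω₂ lam β 0).hamiltonian N from rfl]
    exact hamiltonian_detFlow hω hl.le hβ N hs x
  have h1 : ‖fderiv ℝ j (Φ x)‖ ≤ (5 + 13 * β) * (1 + P.hamiltonian N x) ^ 2 := by
    rw [← hHΦ]; exact norm_fderiv_bondCurrent_le hω.le hl.le hβ γ N i (Φ x)
  have h2 : ‖fderiv ℝ Φ x‖ ≤ Real.exp (K * s) := norm_fderiv_detFlow_le hω hl hβ ha hb' haE hbE hs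
  calc |fderiv ℝ j (Φ x) (fderiv ℝ Φ x (0, Pi.single b 1))| = ‖fderiv ℝ j (Φ x) (fderiv ℝ Φ x (unitP b))‖ := by
        rw [Real.norm_eq_abs, unitP_eq]
    _ ≤ ‖fderiv ℝ j (Φ x)‖ * (‖fderiv ℝ Φ x‖ * ‖(unitP b : PhaseSpace N)‖) :=
        (ContinuousLinearMap.le_opNorm _ _).trans (mul_le_mul_of_nonneg_left (ContinuousLinearMap.le_opNorm _ _) (norm_nonneg _))
    _ ≤ (5 + 13 * β) * (1 + P.hamiltonian N x) ^ 2 * (Real.exp (K * s) * 1) :=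
        mul_le_mul h1 (mul_le_mul h2 (norm_unitP_le b) (norm_nonneg _) (Real.exp_pos _).le) (by positivity) (by positivity)
    _ = _ := by rw [mul_one]

/-- **Square integrability of the tangent map against the Gibbs weight.** For `s ≥ 0`, `T > 0` and
all sites `i, b`: `(∂_{p_b}(j_i ∘ Φ_s))² e^{-H/T} ∈ L¹(dx)` — the tangent rate is `O(1 + √H)`, so the
growth `e^{2sK}` is sub-Gaussian: with `lam a⁴/4 = H + 1`, `4 s k₁ √((H+1)/lam) ≤ (H+1)/(2T) + 8Ts²k₁²/lam`,
and `(1+H)⁴ e^{-H/(2T)} ∈ L¹`. [folklore] -/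
theorem integrable_sq_partialP_currentFlow (N : ℕ) (i b : Fin N) {s : ℝ} (hs : 0 ≤ s) {T : ℝ} (hT : 0 < T) :
    Integrable fun x : PhaseSpace N =>
      (partialP b (fun y : PhaseSpace N => (pinnedChain ω₂ lam β γ).bondCurrent N i (detFlow ω₂ lam β N s y)) x) ^ 2 *
        (pinnedChain ω₂ lam β γ).gibbsDensity N T x := by
  set P := pinnedChain ω₂ lam β γ with hP
  set H := P.hamiltonian N with hH
  set g : PhaseSpace N → ℝ := fun y => P.bondCurrent N i (detFlow ω₂ lam β N s y) with hg
  have hgs : ContDiff ℝ ∞ g := contDiff_currentFlow hω hl hβ γ N i hs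
  have hdgc : Continuous (partialP b g) := continuous_partialP (hgs.of_le (by norm_cast)) one_ne_zero b
  have hρc : Continuous (P.gibbsDensity N T) := pinnedChain_continuous_gibbsDensity ω₂ lam β γ N T
  have hHc : Continuous H := pinnedChain_continuous_hamiltonian ω₂ lam β γ N
  have hH0 : ∀ x, 0 ≤ H x := fun x => pinnedChain_hamiltonian_nonneg hω.le hl.le hβ γ N x
  -- constants
  set k₀ : ℝ := 1 + N * (ω₂ + (N : ℝ) ^ 2) with hk₀
  set k₁ : ℝ := N * (3 * lam + 12 * β * (N : ℝ) ^ 2) with hk₁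
  have hk₁0 : 0 ≤ k₁ := by positivity
  set C : ℝ := (5 + 13 * β) ^ 2 * Real.exp (2 * s * k₀ + 8 * T * s ^ 2 * k₁ ^ 2 / lam + 1 / (2 * T)) with hC
  have h2T : 0 < 2 * T := by positivity
  have hmaj := (integrable_one_add_hamiltonian_pow_four_mul_exp hω hl.le hβ γ N h2T).const_mul C
  refine hmaj.mono' ((hdgc.pow 2).mul hρc).aestronglyMeasurable (Eventually.of_forall fun x => ?_)
  rw [Real.norm_eq_abs, abs_of_nonneg (mul_nonneg (sq_nonneg _) (P.gibbsDensity_pos N T x).le)]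
  -- the box fitted to the level `H x + 1`
  set y : ℝ := H x + 1 with hy
  have hy1 : 1 ≤ y := by rw [hy]; linarith [hH0 x]
  have hy0 : 0 ≤ y := by linarith
  set σ : ℝ := Real.sqrt (4 * y / lam) with hσ
  have hσ0 : 0 ≤ σ := Real.sqrt_nonneg _
  have hσ2 : σ ^ 2 = 4 * y / lam := Real.sq_sqrt (by positivity)
  set a : ℝ := Real.sqrt σ with ha
  have ha0 : 0 ≤ a := Real.sqrt_nonneg _
  have ha2 : a ^ 2 = σ := Real.sq_sqrt hσ0
  have ha4 : lam * a ^ 4 / 4 = y := by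
    rw [show a ^ 4 = (a ^ 2) ^ 2 by ring, ha2, hσ2]; field_simp
  set b' : ℝ := Real.sqrt (2 * y) with hb'
  have hb'0 : 0 ≤ b' := Real.sqrt_nonneg _
  have hb'2 : b' ^ 2 = 2 * y := Real.sq_sqrt (by positivity)
  have hptw := abs_partialP_currentFlow_le hω hl hβ γ N i b hs ha0 hb'0 x
    (by rw [ha4, hy]; exact le_of_eq rfl) (by rw [hb'2, hy]; exact le_of_eq rfl)
  -- the rate at this box
  have hK : 1 + N * ((ω₂ + 3 * lam * a ^ 2) + (N : ℝ) ^ 2 * (1 + 12 * β * a ^ 2)) = k₀ + k₁ * σ := by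
    rw [ha2, hk₀, hk₁]; ring
  rw [hK] at hptw
  -- AM–GM on the `σ`-term of the rate
  have hamgm : 2 * s * (k₁ * σ) ≤ y / (2 * T) + 8 * T * s ^ 2 * k₁ ^ 2 / lam := by
    have hsq : 0 ≤ (lam * σ - 8 * T * s * k₁) ^ 2 := sq_nonneg _
    have hlamσ : lam * σ ^ 2 = 4 * y := by rw [hσ2]; field_simp
    rw [div_add_div _ _ (by positivity) (by positivity), le_div_iff₀ (by positivity)]
    nlinarith [hlamσ, hl, hT]
  have hexp : Real.exp ((k₀ + k₁ * σ) * s) ^ 2 ≤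
      Real.exp (2 * s * k₀ + 8 * T * s ^ 2 * k₁ ^ 2 / lam + 1 / (2 * T)) * Real.exp (H x / (2 * T)) := by
    rw [← Real.exp_nat_mul, ← Real.exp_add]
    refine Real.exp_le_exp.2 ?_
    have : y / (2 * T) = H x / (2 * T) + 1 / (2 * T) := by rw [hy]; field_simp
    push_cast
    nlinarith [hamgm, this]
  -- assemble
  have hsq := pow_le_pow_left₀ (abs_nonneg _) hptw 2
  rw [sq_abs] at hsq
  have hρ : P.gibbsDensity N T x = Real.exp (-(H x) / T) := rfl
  calc (partialP b g x) ^ 2 * P.gibbsDensity N T x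
      ≤ ((5 + 13 * β) * (1 + H x) ^ 2 * Real.exp ((k₀ + k₁ * σ) * s)) ^ 2 * P.gibbsDensity N T x :=
        mul_le_mul_of_nonneg_right hsq (P.gibbsDensity_pos N T x).le
    _ = (5 + 13 * β) ^ 2 * (1 + H x) ^ 4 * Real.exp ((k₀ + k₁ * σ) * s) ^ 2 * Real.exp (-(H x) / T) := by
        rw [hρ]; ring
    _ ≤ (5 + 13 * β) ^ 2 * (1 + H x) ^ 4 *
          (Real.exp (2 * s * k₀ + 8 * T * s ^ 2 * k₁ ^ 2 / lam + 1 / (2 * T)) * Real.exp (H x / (2 * T))) *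
          Real.exp (-(H x) / T) := by
        gcongr
    _ = C * ((1 + H x) ^ 4 * Real.exp (-(H x) / (2 * T))) := by
        rw [hC]
        have e : Real.exp (H x / (2 * T)) * Real.exp (-(H x) / T) = Real.exp (-(H x) / (2 * T)) := by
          rw [← Real.exp_add]; congr 1; field_simp; ring
        calc _ = (5 + 13 * β) ^ 2 * Real.exp (2 * s * k₀ + 8 * T * s ^ 2 * k₁ ^ 2 / lam + 1 / (2 * T)) *
              ((1 + H x) ^ 4 * (Real.exp (H x / (2 * T)) * Real.exp (-(H x) / T))) := by ring
          _ = _ := by rw [e]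

/-- Hence `∂_{p_b}(j_i ∘ Φ_s) ∈ L²(μ_T)` (`s ≥ 0`, `T > 0`). [folklore] -/
theorem memLp_partialP_currentFlow (N : ℕ) (i b : Fin N) {s : ℝ} (hs : 0 ≤ s) {T : ℝ} (hT : 0 < T) :
    MemLp (partialP b (fun y : PhaseSpace N => (pinnedChain ω₂ lam β γ).bondCurrent N i (detFlow ω₂ lam β N s y)))
      2 ((pinnedChain ω₂ lam β γ).gibbsMeasure N T) :=
  memLp_of_integrable_sq_mul_gibbsDensity hω hl.le hβ γ N hT
    (continuous_partialP ((contDiff_currentFlow hω hl hβ γ N i hs).of_le (by norm_cast)) one_ne_zero b)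
    (integrable_sq_partialP_currentFlow hω hl hβ γ N i b hs hT)

end Flow


end Summit.AtomisticToContinuum.FouriersLaw.Theorems.OddSectorIrreversibility.Corrector

end
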